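import Mathlib
import HarnessLib
import Summits.Ventures.LatticeQCDFlow.Exactness.ReplicaProductDoeblin

/-!
# Independent exact updates of the replicas preserve the product law; the PTBC cycle skeleton converges to it

HONEST FRAMING: exact (Metropolis-corrected) sampling algorithms for lattice gauge theory;
figures of merit are autocorrelation/cost numbers at stated couplings and volumes; no
continuum-physics claim.

Venture `LatticeQCDFlow` (cell pub-lqcd), topic `Exactness`, FANOUT row 9 (eng-latcore, the
engine `latflow.core.ptbc`).  NEW WORK of the cell over the tree (`ReplicaProductDoeblin.lean`:
`replicaLift`, `replicaSweep`, the Doeblin minorant of a sweep through every replica and of the cycle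
with any exact move; `RefreshScan.lean`: `lintegral_siteLift`, `lintegral_pi_lmarginal`,
`uniformlyErgodic_of_minorised`; `DoeblinUniqueness.lean`).  Nothing here is cited as a fact.

* §1 **`invariant_pi_replicaLift`** — if the in-replica kernel `K r` leaves the probability law `π r`
  invariant, its lift leaves the product law `⊗_r π r` invariant (Tonelli over replica `r`: the
  one-site marginal of `g ∘ update` against `π r ∘ K r = π r`); **`invariant_pi_replicaSweep`** — so
  does a sweep of such updates over any list of replicas.
* §2 **`replicaCycle_convergesTo_pi`**, **`pi_unique_invariant_replicaCycle`** — independent Doeblin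
  exact updates of every replica (`(K r)(x,·) ≥ ε · ν r`, `π r ∘ K r = π r`) followed by any Markov move
  `η` leaving `⊗π` invariant (the PTBC swaps and the translation, `PTBCSwap.lean`): the cycle
  `η ∘ₖ replicaSweep K L` converges to `⊗_r π r` geometrically in total variation from EVERY initial
  law, `|μ₀ Cᵗ(A) − (⊗π)(A)| ≤ (1 − ε^{|L|})ᵗ`, and `⊗_r π r` is its ONLY invariant probability law.

NOT CLAIMED: the identification of the PTBC factors with these kernels (the in-replica sweeps are
`HeatBathSweepErgodic` / `CabibboMarinariLatticeErgodic` sweeps with the defect-weighted action of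
replica `r`; the lift of the two-replica swap of `PTBCSwap.lean` to the `R`-replica product is not
written here); rates.
-/

noncomputable section

namespace Summit.Ventures.LatticeQCDFlow.Exactness

open MeasureTheory ProbabilityTheory Set Function
open scoped ENNReal

section Invariant

variable {R : Type*} [DecidableEq R] [Fintype R] {X : R → Type*} [∀ r, MeasurableSpace (X r)]
variable {K : ∀ r, Kernel (X r) (X r)} [∀ r, IsMarkovKernel (K r)] {π : ∀ r, Measure (X r)}
  [∀ r, IsProbabilityMeasure (π r)]

omit [Fintype R] [∀ r, IsProbabilityMeasure (π r)] in
/-- Integrating the lift of `K r` and then the `r`-marginal is the `r`-marginal, when `π r ∘ K r = π r`. -/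
theorem lmarginal_lintegral_replicaLift (hK : ∀ r, Kernel.Invariant (K r) (π r)) (r : R)
    {g : (∀ r, X r) → ℝ≥0∞} (hg : Measurable g) (ω : ∀ r, X r) :
    (∫⋯∫⁻_{r}, (fun ω' => ∫⁻ ξ, g ξ ∂(replicaLift K r ω')) ∂π) ω = (∫⋯∫⁻_{r}, g ∂π) ω := by
  rw [lmarginal_singleton, lmarginal_singleton]
  have hlift : ∀ ω' : ∀ r, X r, ∫⁻ ξ, g ξ ∂(replicaLift K r ω') = ∫⁻ y, g (update ω' r y) ∂(K r (ω' r)) := fun ω' => by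
    rw [replicaLift, lintegral_siteLift _ _ _ hg, Kernel.comap_apply]
  simp only [hlift, update_self, update_idem]
  -- `∫ (∫ g(ω[r ↦ y]) dK(x)(y)) dπ_r(x) = ∫ g(ω[r ↦ y]) d(π_r ∘ K)(y) = ∫ g(ω[r ↦ y]) dπ_r(y)`
  have hmeas : Measurable fun y : X r => g (update ω r y) := hg.comp (measurable_update ω)
  rw [← Measure.lintegral_bind (Kernel.aemeasurable (K r)) hmeas.aemeasurable, (hK r).def]

/-- **THE LIFT OF AN EXACT IN-REPLICA UPDATE IS EXACT FOR THE PRODUCT LAW.** -/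
theorem invariant_pi_replicaLift (hK : ∀ r, Kernel.Invariant (K r) (π r)) (r : R) :
    Kernel.Invariant (replicaLift K r) (Measure.pi π) := by
  change (Measure.pi π).bind ⇑(replicaLift K r) = Measure.pi π
  refine Measure.ext_of_lintegral _ fun g hg => ?_
  have hF : Measurable fun ω' : ∀ r, X r => ∫⁻ ξ, g ξ ∂(replicaLift K r ω') :=
    (Measure.measurable_lintegral hg).comp (replicaLift K r).measurable
  rw [Measure.lintegral_bind (Kernel.aemeasurable _) hg.aemeasurable, ← lintegral_pi_lmarginal (μ := π) r hF,
    ← lintegral_pi_lmarginal (μ := π) r hg]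
  exact lintegral_congr fun ω => lmarginal_lintegral_replicaLift hK r hg ω

/-- **A sweep of exact in-replica updates is exact for the product law.** -/
theorem invariant_pi_replicaSweep (hK : ∀ r, Kernel.Invariant (K r) (π r)) (L : List R) :
    Kernel.Invariant (replicaSweep K L) (Measure.pi π) := by
  refine invariant_cycle fun κ hκ => ?_
  obtain ⟨r, -, rfl⟩ := List.mem_map.1 hκ
  exact invariant_pi_replicaLift hK r

variable {ν : ∀ r, Measure (X r)} [∀ r, IsProbabilityMeasure (ν r)] {ε : ℝ≥0∞}

/-- **THE PTBC CYCLE SKELETON CONVERGES TO THE PRODUCT LAW.**  Independent Doeblin exact updates of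
every replica (`(K r)(x,·) ≥ ε · ν r`, `π r ∘ K r = π r`, `L` through every replica) followed by any
Markov move `η` leaving `⊗π` invariant: `|μ₀ Cᵗ(A) − (⊗π)(A)| ≤ (1 − ε^{|L|})ᵗ` for every initial law. -/
theorem replicaCycle_convergesTo_pi (h : ∀ r (x : X r), ε • ν r ≤ K r x)
    (hK : ∀ r, Kernel.Invariant (K r) (π r)) {L : List R} (hL : ∀ r, r ∈ L)
    (η : Kernel (∀ r, X r) (∀ r, X r)) [IsMarkovKernel η] (hη : Kernel.Invariant η (Measure.pi π))
    (μ₀ : Measure (∀ r, X r)) [IsProbabilityMeasure μ₀] (t : ℕ) (A : Set (∀ r, X r)) :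
    |((fun m : Measure (∀ r, X r) => m.bind (η ∘ₖ replicaSweep K L))^[t] μ₀).real A - (Measure.pi π).real A| ≤
      (1 - (ε ^ L.length).toReal) ^ t :=
  replicaCycle_uniformlyErgodic h hL η (hη.comp (invariant_pi_replicaSweep hK L)) μ₀ t A

/-- **… and the product law is the ONLY invariant probability law of the cycle** (`ε > 0`). -/
theorem pi_unique_invariant_replicaCycle (h : ∀ r (x : X r), ε • ν r ≤ K r x) (hε : 0 < ε)
    (hK : ∀ r, Kernel.Invariant (K r) (π r)) {L : List R} (hL : ∀ r, r ∈ L)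
    (η : Kernel (∀ r, X r) (∀ r, X r)) [IsMarkovKernel η] (hη : Kernel.Invariant η (Measure.pi π))
    {P' : Measure (∀ r, X r)} [IsProbabilityMeasure P'] (hP' : Kernel.Invariant (η ∘ₖ replicaSweep K L) P') :
    P' = Measure.pi π :=
  replicaCycle_invariant_unique h hε hL η (hη.comp (invariant_pi_replicaSweep hK L)) hP'

end Invariant

end Summit.Ventures.LatticeQCDFlow.Exactness
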